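import Mathlib
import HarnessLib
import Summits.Ventures.LatticeQCDFlow.Scaling.AutoregressiveGaugePlaquetteReads

/-!
# LatticeQCDFlow / Scaling — PROPOSAL AVERAGING AT A CORNER: replacing a link-blind proposal density by its
# Haar average over the partner link never increases its Wilson-weighted `L¹` distance to the exact conditional

HONEST FRAMING: exact (Metropolis-corrected) sampling algorithms for lattice gauge theory;
figures of merit are autocorrelation/cost numbers at stated couplings and volumes; no
continuum-physics claim.

Venture `LatticeQCDFlow` (cell pub-lqcd), topic `Scaling`, FANOUT row 30 (lean-1, GEN-18) — OUR WORK for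
THEORY-2 §4 row C5 (gauge case), the general form of `Scaling/AutoregressiveGaugeBlindProposal` ("Haar is the
best blind proposal").  Any `d`, `L`, compact group `G` (Haar probability `μ`, `π = μ^{⊗E}`), bounded measurable
gauge-invariant weight `F`, integrated links `s`, `N = A_s F`, `M = A_{insert a s} F` for a link `a`, and a
bounded measurable "proposal" `q` (any function of the configuration).  At a site `y` whose links outside `s`
are exactly two retained links `ℓ₁`, `ℓ₂`, if `q` is BLIND to `ℓ₂` then the Haar average of `q` over the
coordinate `ℓ₁`, `q̄(U) = ∫ q(U[ℓ₁ ↦ v]) dv`, satisfies `∫ |N − q̄·M| dπ ≤ ∫ |N − q·M| dπ`: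

* §1 **`integral_abs_sub_avg_le_of_moves`** — the abstract mechanism: a family of `π`-preserving moves
  `T_g` fixing `N` and `M` and acting on `q` through the `ℓ₁`-coordinate by maps `c_g` that push Haar to Haar;
  average over `g` (Fubini, `‖∫·‖ ≤ ∫‖·‖`).
* §2 the three corners: **`integral_abs_sub_avg_le_of_cornerThrough`** (`ℓ₁` arrives at `y`, `ℓ₂` leaves;
  move `U ↦ U[ℓ₁ ↦ U_{ℓ₁}g⁻¹][ℓ₂ ↦ gU_{ℓ₂}]`, tree `coordAvg_pathHolonomy`), **`…_of_cornerOut`** (both leave;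
  `(gU_{ℓ₁}, gU_{ℓ₂})`), **`…_of_cornerIn`** (both arrive; `(U_{ℓ₁}g⁻¹, U_{ℓ₂}g⁻¹)`) — for ANY `a` (the
  conditional may be that of `ℓ₁`, of `ℓ₂`, or of a third link).

READING (value-free): iterating along the corners of a plaquette (sequel), a proposal for the closing link that
ignores ANY ONE staple link is, in Wilson-weighted `L¹` (average total variation), no better than the Haar prior,
for every compact gauge group and dimension; with `Scaling/AutoregressiveGaugePlaquetteMarginal` the gap is
`≥ ⟨W_{1×1}⟩_β/2`.  NOT CLAIMED: proposals reading both corner links; any number of ours.  Elementary over the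
parents; no `def`; nothing is cited as a fact; no `sorry`.
-/

noncomputable section

namespace Summit.Ventures.LatticeQCDFlow.Theory2.Autoregressive

open MeasureTheory Function Set
open Literature.MathematicalPhysics.QuantumFieldTheory
open Summit.Ventures.LatticeQCDFlow.Exactness

variable {d L : ℕ} {G : Type*} [Group G] [TopologicalSpace G] [IsTopologicalGroup G] [CompactSpace G]
  [SecondCountableTopology G] [MeasurableSpace G] [BorelSpace G] [NeZero L]

/-! ## §1 The abstract averaging mechanism -/

omit [SecondCountableTopology G] in
/-- **PROPOSAL AVERAGING** (abstract form).  Let `T_g` (`g ∈ G`) be measurable equivalences of the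
configuration space preserving product Haar `π`, fixing `N = A_s F` and `M = A_{insert a s} F`, and acting on
the bounded measurable `q` through the `ℓ₁`-coordinate: `q(T_g U) = q(U[ℓ₁ ↦ c_g(U_{ℓ₁})])` with jointly
measurable `c` such that each `g ↦ c_g(v)` pushes Haar to Haar.  Then
`∫ |N − q̄·M| dπ ≤ ∫ |N − q·M| dπ`, `q̄(U) = ∫ q(U[ℓ₁ ↦ v]) dv`. [ours] -/
theorem integral_abs_sub_avg_le_of_moves (s : Finset (Edge d L)) (a ℓ₁ : Edge d L)
    {F : GaugeConfig d L G → ℝ} (hFm : Measurable F) (hFb : ∃ C, ∀ U, |F U| ≤ C)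
    {q : GaugeConfig d L G → ℝ} (hqm : Measurable q) (hqb : ∃ C, ∀ U, |q U| ≤ C)
    (T : G → (GaugeConfig d L G ≃ᵐ GaugeConfig d L G))
    (hTmp : ∀ g, MeasurePreserving (T g) (Measure.pi fun _ : Edge d L => haarProbability G)
      (Measure.pi fun _ : Edge d L => haarProbability G))
    (hNT : ∀ g U, coordAvg (haarProbability G) s F (T g U) = coordAvg (haarProbability G) s F U)
    (hMT : ∀ g U, coordAvg (haarProbability G) (insert a s) F (T g U) =
      coordAvg (haarProbability G) (insert a s) F U)
    (c : G → G → G) (hc : Measurable (uncurry c))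
    (hcmp : ∀ v : G, MeasurePreserving (fun g => c g v) (haarProbability G) (haarProbability G))
    (hqT : ∀ g U, q (T g U) = q (update U ℓ₁ (c g (U ℓ₁)))) :
    ∫ U, |coordAvg (haarProbability G) s F U -
          (∫ v, q (update U ℓ₁ v) ∂(haarProbability G)) * coordAvg (haarProbability G) (insert a s) F U|
        ∂Measure.pi (fun _ : Edge d L => haarProbability G) ≤
      ∫ U, |coordAvg (haarProbability G) s F U - q U * coordAvg (haarProbability G) (insert a s) F U|
        ∂Measure.pi (fun _ : Edge d L => haarProbability G) := by
  classical
  set μ := haarProbability G with hμ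
  set π := Measure.pi (fun _ : Edge d L => μ) with hπ
  set N := coordAvg μ s F with hN
  set M := coordAvg μ (insert a s) F with hM
  obtain ⟨CF, hCF⟩ := hFb
  obtain ⟨Cq, hCq⟩ := hqb
  have hFlo : ∀ U, -CF ≤ F U := fun U => (abs_le.1 (hCF U)).1
  have hFhi : ∀ U, F U ≤ CF := fun U => (abs_le.1 (hCF U)).2
  have hNb : ∀ U, |N U| ≤ CF := fun U => abs_le.2 (coordAvg_mem_Icc μ s hFm hFlo hFhi U)
  have hMb : ∀ U, |M U| ≤ CF := fun U => abs_le.2 (coordAvg_mem_Icc μ (insert a s) hFm hFlo hFhi U)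
  have hNm : Measurable N := measurable_coordAvg μ s hFm
  have hMm : Measurable M := measurable_coordAvg μ (insert a s) hFm
  have hCq0 : 0 ≤ Cq := (abs_nonneg _).trans (hCq 1)
  -- the integrand after the move, as a function of `(g, U)`
  set φ : G → GaugeConfig d L G → ℝ := fun g U => |N U - q (update U ℓ₁ (c g (U ℓ₁))) * M U| with hφ
  -- Step 1: for every `g` the integral is unchanged by the move
  have hstep1 : ∀ g : G, ∫ U, |N U - q U * M U| ∂π = ∫ U, φ g U ∂π := by
    intro g
    have h := (hTmp g).integral_comp' (fun U => |N U - q U * M U|)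
    rw [← h]
    refine integral_congr_ae (ae_of_all _ fun U => ?_)
    show |N (T g U) - q (T g U) * M (T g U)| = |N U - q (update U ℓ₁ (c g (U ℓ₁))) * M U|
    rw [hNT, hMT, hqT]
  -- joint measurability
  have hupd : Measurable fun p : G × GaugeConfig d L G => update p.2 ℓ₁ (c p.1 (p.2 ℓ₁)) := by
    refine measurable_pi_lambda _ fun e => ?_
    by_cases he : e = ℓ₁
    · subst he
      simp only [update_self]
      exact hc.comp (measurable_fst.prodMk ((measurable_pi_apply _).comp measurable_snd))
    · simp only [update_of_ne he]
      exact (measurable_pi_apply e).comp measurable_snd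
  have hφm : Measurable (uncurry φ) := by
    have h1 : Measurable fun p : G × GaugeConfig d L G => N p.2 := hNm.comp measurable_snd
    have h2 : Measurable fun p : G × GaugeConfig d L G => q (update p.2 ℓ₁ (c p.1 (p.2 ℓ₁))) :=
      hqm.comp hupd
    have h3 : Measurable fun p : G × GaugeConfig d L G => M p.2 := hMm.comp measurable_snd
    exact (h1.sub (h2.mul h3)).abs
  have hφb : ∀ g U, |φ g U| ≤ CF + Cq * CF := by
    intro g U
    simp only [hφ, abs_abs]
    calc |N U - q (update U ℓ₁ (c g (U ℓ₁))) * M U|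
        ≤ |N U| + |q (update U ℓ₁ (c g (U ℓ₁))) * M U| := abs_sub _ _
      _ ≤ CF + Cq * CF := by
          rw [abs_mul]; exact add_le_add (hNb U) (mul_le_mul (hCq _) (hMb U) (abs_nonneg _) hCq0)
  have hφi : Integrable (uncurry φ) (μ.prod π) :=
    Integrable.mono' (integrable_const _) hφm.aestronglyMeasurable
      (ae_of_all _ fun p => by rw [Real.norm_eq_abs]; exact hφb p.1 p.2)
  -- Step 2: average over `g` and swap the integrals
  have hstep2 : ∫ U, |N U - q U * M U| ∂π = ∫ U, ∫ g, φ g U ∂μ ∂π := by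
    have hconst : ∫ g, (∫ U, |N U - q U * M U| ∂π) ∂μ = ∫ U, |N U - q U * M U| ∂π := by
      rw [integral_const, Measure.real, measure_univ, ENNReal.toReal_one, one_smul]
    rw [← hconst, integral_congr_ae (ae_of_all _ fun g => hstep1 g)]
    exact integral_integral_swap hφi
  -- Step 3: `∫_G q(U[ℓ₁ ↦ c_g(U_{ℓ₁})]) dg = q̄(U)`
  have hqvm : ∀ U : GaugeConfig d L G, Measurable fun v => q (update U ℓ₁ v) :=
    fun U => hqm.comp (measurable_update U)
  have havg : ∀ U : GaugeConfig d L G,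
      ∫ g, q (update U ℓ₁ (c g (U ℓ₁))) ∂μ = ∫ v, q (update U ℓ₁ v) ∂μ := by
    intro U
    have h := integral_map (hcmp (U ℓ₁)).measurable.aemeasurable (hqvm U).aestronglyMeasurable
      (μ := μ) (φ := fun g => c g (U ℓ₁))
    rw [(hcmp (U ℓ₁)).map_eq] at h
    exact h.symm
  -- Step 4: pointwise `|N − q̄ M| ≤ ∫_G φ g U dg`
  have hinner : ∀ U : GaugeConfig d L G,
      |N U - (∫ v, q (update U ℓ₁ v) ∂μ) * M U| ≤ ∫ g, φ g U ∂μ := by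
    intro U
    have hqi : Integrable (fun g : G => q (update U ℓ₁ (c g (U ℓ₁)))) μ := by
      refine Integrable.mono' (integrable_const Cq) ?_ (ae_of_all _ fun g => by
        rw [Real.norm_eq_abs]; exact hCq _)
      exact (hqm.comp (hupd.comp (measurable_id.prodMk measurable_const))).aestronglyMeasurable
    have hlin : ∫ g, (N U - q (update U ℓ₁ (c g (U ℓ₁))) * M U) ∂μ =
        N U - (∫ v, q (update U ℓ₁ v) ∂μ) * M U := by
      rw [integral_sub (integrable_const _) (hqi.mul_const _), integral_const, integral_mul_const, havg U,
        Measure.real, measure_univ, ENNReal.toReal_one, one_smul]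
    calc |N U - (∫ v, q (update U ℓ₁ v) ∂μ) * M U|
        = |∫ g, (N U - q (update U ℓ₁ (c g (U ℓ₁))) * M U) ∂μ| := by rw [hlin]
      _ = ‖∫ g, (N U - q (update U ℓ₁ (c g (U ℓ₁))) * M U) ∂μ‖ := (Real.norm_eq_abs _).symm
      _ ≤ ∫ g, ‖N U - q (update U ℓ₁ (c g (U ℓ₁))) * M U‖ ∂μ := norm_integral_le_integral_norm _
      _ = ∫ g, φ g U ∂μ := by simp only [hφ, Real.norm_eq_abs]
  -- Step 5: integrate
  have hqbm : Measurable fun U : GaugeConfig d L G => ∫ v, q (update U ℓ₁ v) ∂μ := by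
    have hm : Measurable fun p : GaugeConfig d L G × G => q (update p.1 ℓ₁ p.2) :=
      hqm.comp (measurable_pi_lambda _ fun e => by
        by_cases he : e = ℓ₁
        · subst he; simp only [update_self]; exact measurable_snd
        · simp only [update_of_ne he]; exact (measurable_pi_apply e).comp measurable_fst)
    exact (hm.stronglyMeasurable.integral_prod_right' (ν := μ)).measurable
  have hqbb : ∀ U : GaugeConfig d L G, |∫ v, q (update U ℓ₁ v) ∂μ| ≤ Cq := fun U => by
    have h := norm_integral_le_of_norm_le_const (μ := μ) (f := fun v => q (update U ℓ₁ v)) (C := Cq)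
      (ae_of_all _ fun v => by rw [Real.norm_eq_abs]; exact hCq _)
    rw [Real.norm_eq_abs] at h
    simpa [Measure.real, measure_univ] using h
  have hli : Integrable (fun U => |N U - (∫ v, q (update U ℓ₁ v) ∂μ) * M U|) π :=
    Integrable.mono' (integrable_const (CF + Cq * CF)) ((hNm.sub (hqbm.mul hMm)).abs.aestronglyMeasurable)
      (ae_of_all _ fun U => by
        rw [Real.norm_eq_abs, abs_abs]
        refine (abs_sub _ _).trans (add_le_add (hNb U) ?_)
        rw [abs_mul]; exact mul_le_mul (hqbb U) (hMb U) (abs_nonneg _) hCq0)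
  have hri : Integrable (fun U => ∫ g, φ g U ∂μ) π := MeasureTheory.Integrable.integral_prod_right hφi
  rw [hstep2]
  exact integral_mono hli hri hinner

/-! ## §2 The three corners -/

omit [SecondCountableTopology G] in
/-- `g ↦ v·g⁻¹` pushes Haar to Haar (compact groups are unimodular). [ours] -/
theorem measurePreserving_mul_inv_left (v : G) :
    MeasurePreserving (fun g : G => v * g⁻¹) (haarProbability G) (haarProbability G) :=
  (measurePreserving_mul_left (haarProbability G) v).comp (Measure.measurePreserving_inv (haarProbability G))

/-- **THROUGH a corner** (`ℓ₁` arrives at `y`, `ℓ₂` leaves, all other links at `y` integrated): for `q` blind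
to `ℓ₂`, `∫ |N − q̄·M| ≤ ∫ |N − q·M|` with `q̄` the Haar average of `q` over `ℓ₁`. [ours] -/
theorem integral_abs_sub_avg_le_of_cornerThrough (s : Finset (Edge d L)) (a : Edge d L)
    {F : GaugeConfig d L G → ℝ} (hF : IsGaugeInvariant F) (hFm : Measurable F) (hFb : ∃ C, ∀ U, |F U| ≤ C)
    {y : Site d L} {ℓ₁ ℓ₂ : Edge d L} (hne : ℓ₁ ≠ ℓ₂) (h₁ : ℓ₁.1.shift ℓ₁.2 = y) (h₁' : ℓ₁.1 ≠ y)
    (h₂ : ℓ₂.1 = y) (h₂' : ℓ₂.1.shift ℓ₂.2 ≠ y)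
    (hstar : ∀ e : Edge d L, e.1 = y ∨ e.1.shift e.2 = y → e ≠ ℓ₁ → e ≠ ℓ₂ → e ∈ s)
    {q : GaugeConfig d L G → ℝ} (hqm : Measurable q) (hqb : ∃ C, ∀ U, |q U| ≤ C)
    (hq₂ : ∀ U v, q (update U ℓ₂ v) = q U) :
    ∫ U, |coordAvg (haarProbability G) s F U -
          (∫ v, q (update U ℓ₁ v) ∂(haarProbability G)) * coordAvg (haarProbability G) (insert a s) F U|
        ∂Measure.pi (fun _ : Edge d L => haarProbability G) ≤
      ∫ U, |coordAvg (haarProbability G) s F U - q U * coordAvg (haarProbability G) (insert a s) F U|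
        ∂Measure.pi (fun _ : Edge d L => haarProbability G) := by
  classical
  set μ := haarProbability G with hμ
  let T : G → (GaugeConfig d L G ≃ᵐ GaugeConfig d L G) := fun g =>
    MeasurableEquiv.piCongrRight fun e =>
      if e = ℓ₁ then MeasurableEquiv.mulRight g⁻¹
      else if e = ℓ₂ then MeasurableEquiv.mulLeft g else MeasurableEquiv.refl G
  have hT : ∀ (g : G) (U : GaugeConfig d L G),
      T g U = update (update U ℓ₁ (U ℓ₁ * g⁻¹)) ℓ₂ (g * U ℓ₂) := by
    intro g U
    funext e
    by_cases he2 : e = ℓ₂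
    · subst he2; simp [T, MeasurableEquiv.piCongrRight, hne.symm]
    · by_cases he1 : e = ℓ₁
      · subst he1; simp [T, MeasurableEquiv.piCongrRight, update_of_ne hne]
      · simp [T, MeasurableEquiv.piCongrRight, he1, he2]
  have hTmp : ∀ g : G, MeasurePreserving (T g) (Measure.pi fun _ : Edge d L => μ)
      (Measure.pi fun _ : Edge d L => μ) := by
    intro g
    refine measurePreserving_pi (fun _ : Edge d L => μ) (fun _ : Edge d L => μ) fun e => ?_
    by_cases he1 : e = ℓ₁
    · subst he1; simpa using measurePreserving_mul_right μ g⁻¹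
    · by_cases he2 : e = ℓ₂
      · subst he2; simpa [he1] using measurePreserving_mul_left μ g
      · simpa [he1, he2] using MeasurePreserving.id μ
  have hmove : ∀ (s' : Finset (Edge d L)),
      (∀ e : Edge d L, e.1 = y ∨ e.1.shift e.2 = y → e ≠ ℓ₁ → e ≠ ℓ₂ → e ∈ s') →
      ∀ g U, coordAvg μ s' F (T g U) = coordAvg μ s' F U := by
    intro s' hst g U
    rw [hT]; exact coordAvg_pathHolonomy hF hne h₁ h₁' h₂ h₂' hst U g
  refine integral_abs_sub_avg_le_of_moves s a ℓ₁ hFm hFb hqm hqb T hTmp (hmove s hstar)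
    (hmove (insert a s) fun e he h1 h2 => Finset.mem_insert_of_mem (hstar e he h1 h2))
    (fun g v => v * g⁻¹) (measurable_snd.mul measurable_fst.inv) (fun v => measurePreserving_mul_inv_left v)
    fun g U => ?_
  rw [hT, hq₂]

/-- **Both links LEAVING the corner** (all other links at `y` integrated): for `q` blind to `ℓ₂`,
`∫ |N − q̄·M| ≤ ∫ |N − q·M|`. [ours] -/
theorem integral_abs_sub_avg_le_of_cornerOut (s : Finset (Edge d L)) (a : Edge d L)
    {F : GaugeConfig d L G → ℝ} (hF : IsGaugeInvariant F) (hFm : Measurable F) (hFb : ∃ C, ∀ U, |F U| ≤ C)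
    {y : Site d L} {ℓ₁ ℓ₂ : Edge d L} (hne : ℓ₁ ≠ ℓ₂) (h₁ : ℓ₁.1 = y) (h₁' : ℓ₁.1.shift ℓ₁.2 ≠ y)
    (h₂ : ℓ₂.1 = y) (h₂' : ℓ₂.1.shift ℓ₂.2 ≠ y)
    (hstar : ∀ e : Edge d L, e.1 = y ∨ e.1.shift e.2 = y → e ≠ ℓ₁ → e ≠ ℓ₂ → e ∈ s)
    {q : GaugeConfig d L G → ℝ} (hqm : Measurable q) (hqb : ∃ C, ∀ U, |q U| ≤ C)
    (hq₂ : ∀ U v, q (update U ℓ₂ v) = q U) :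
    ∫ U, |coordAvg (haarProbability G) s F U -
          (∫ v, q (update U ℓ₁ v) ∂(haarProbability G)) * coordAvg (haarProbability G) (insert a s) F U|
        ∂Measure.pi (fun _ : Edge d L => haarProbability G) ≤
      ∫ U, |coordAvg (haarProbability G) s F U - q U * coordAvg (haarProbability G) (insert a s) F U|
        ∂Measure.pi (fun _ : Edge d L => haarProbability G) := by
  classical
  set μ := haarProbability G with hμ
  let T : G → (GaugeConfig d L G ≃ᵐ GaugeConfig d L G) := fun g =>
    MeasurableEquiv.piCongrRight fun e =>
      if e = ℓ₁ then MeasurableEquiv.mulLeft g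
      else if e = ℓ₂ then MeasurableEquiv.mulLeft g else MeasurableEquiv.refl G
  have hT : ∀ (g : G) (U : GaugeConfig d L G),
      T g U = update (update U ℓ₁ (g * U ℓ₁)) ℓ₂ (g * U ℓ₂) := by
    intro g U
    funext e
    by_cases he2 : e = ℓ₂
    · subst he2; simp [T, MeasurableEquiv.piCongrRight, hne.symm]
    · by_cases he1 : e = ℓ₁
      · subst he1; simp [T, MeasurableEquiv.piCongrRight, update_of_ne hne]
      · simp [T, MeasurableEquiv.piCongrRight, he1, he2]
  have hTmp : ∀ g : G, MeasurePreserving (T g) (Measure.pi fun _ : Edge d L => μ)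
      (Measure.pi fun _ : Edge d L => μ) := by
    intro g
    refine measurePreserving_pi (fun _ : Edge d L => μ) (fun _ : Edge d L => μ) fun e => ?_
    by_cases he1 : e = ℓ₁
    · subst he1; simpa using measurePreserving_mul_left μ g
    · by_cases he2 : e = ℓ₂
      · subst he2; simpa [he1] using measurePreserving_mul_left μ g
      · simpa [he1, he2] using MeasurePreserving.id μ
  -- the corner-out move preserves every marginal over a set containing the other links at `y`
  have hmove : ∀ (s' : Finset (Edge d L)),
      (∀ e : Edge d L, e.1 = y ∨ e.1.shift e.2 = y → e ≠ ℓ₁ → e ≠ ℓ₂ → e ∈ s') →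
      ∀ g U, coordAvg μ s' F (T g U) = coordAvg μ s' F U := by
    intro s' hst g U
    rw [hT]
    refine coordAvg_eq_of_gaugeRelated_off s' hF (Pi.mulSingle y g) fun e he => ?_
    by_cases he₂ : e = ℓ₂
    · subst he₂
      rw [update_self, gaugeTransform_mulSingle_apply_of_fst_eq g U h₂ h₂']
    rw [update_of_ne he₂]
    by_cases he₁ : e = ℓ₁
    · subst he₁
      rw [update_self, gaugeTransform_mulSingle_apply_of_fst_eq g U h₁ h₁']
    rw [update_of_ne he₁]
    have hni : ¬ (e.1 = y ∨ e.1.shift e.2 = y) := fun hi => he (hst e hi he₁ he₂)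
    exact (gaugeTransform_mulSingle_apply_of_not_incident y g U (fun h1 => hni (Or.inl h1))
      (fun h2 => hni (Or.inr h2))).symm
  refine integral_abs_sub_avg_le_of_moves s a ℓ₁ hFm hFb hqm hqb T hTmp (hmove s hstar)
    (hmove (insert a s) fun e he h1 h2 => Finset.mem_insert_of_mem (hstar e he h1 h2))
    (fun g v => g * v) (measurable_fst.mul measurable_snd) (fun v => measurePreserving_mul_right μ v)
    fun g U => ?_
  rw [hT, hq₂]

/-- **Both links ARRIVING at the corner** (all other links at `y` integrated): for `q` blind to `ℓ₂`,
`∫ |N − q̄·M| ≤ ∫ |N − q·M|`. [ours] -/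
theorem integral_abs_sub_avg_le_of_cornerIn (s : Finset (Edge d L)) (a : Edge d L)
    {F : GaugeConfig d L G → ℝ} (hF : IsGaugeInvariant F) (hFm : Measurable F) (hFb : ∃ C, ∀ U, |F U| ≤ C)
    {y : Site d L} {ℓ₁ ℓ₂ : Edge d L} (hne : ℓ₁ ≠ ℓ₂) (h₁ : ℓ₁.1.shift ℓ₁.2 = y) (h₁' : ℓ₁.1 ≠ y)
    (h₂ : ℓ₂.1.shift ℓ₂.2 = y) (h₂' : ℓ₂.1 ≠ y)
    (hstar : ∀ e : Edge d L, e.1 = y ∨ e.1.shift e.2 = y → e ≠ ℓ₁ → e ≠ ℓ₂ → e ∈ s)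
    {q : GaugeConfig d L G → ℝ} (hqm : Measurable q) (hqb : ∃ C, ∀ U, |q U| ≤ C)
    (hq₂ : ∀ U v, q (update U ℓ₂ v) = q U) :
    ∫ U, |coordAvg (haarProbability G) s F U -
          (∫ v, q (update U ℓ₁ v) ∂(haarProbability G)) * coordAvg (haarProbability G) (insert a s) F U|
        ∂Measure.pi (fun _ : Edge d L => haarProbability G) ≤
      ∫ U, |coordAvg (haarProbability G) s F U - q U * coordAvg (haarProbability G) (insert a s) F U|
        ∂Measure.pi (fun _ : Edge d L => haarProbability G) := by
  classical
  set μ := haarProbability G with hμ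
  let T : G → (GaugeConfig d L G ≃ᵐ GaugeConfig d L G) := fun g =>
    MeasurableEquiv.piCongrRight fun e =>
      if e = ℓ₁ then MeasurableEquiv.mulRight g⁻¹
      else if e = ℓ₂ then MeasurableEquiv.mulRight g⁻¹ else MeasurableEquiv.refl G
  have hT : ∀ (g : G) (U : GaugeConfig d L G),
      T g U = update (update U ℓ₁ (U ℓ₁ * g⁻¹)) ℓ₂ (U ℓ₂ * g⁻¹) := by
    intro g U
    funext e
    by_cases he2 : e = ℓ₂
    · subst he2; simp [T, MeasurableEquiv.piCongrRight, hne.symm]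
    · by_cases he1 : e = ℓ₁
      · subst he1; simp [T, MeasurableEquiv.piCongrRight, update_of_ne hne]
      · simp [T, MeasurableEquiv.piCongrRight, he1, he2]
  have hTmp : ∀ g : G, MeasurePreserving (T g) (Measure.pi fun _ : Edge d L => μ)
      (Measure.pi fun _ : Edge d L => μ) := by
    intro g
    refine measurePreserving_pi (fun _ : Edge d L => μ) (fun _ : Edge d L => μ) fun e => ?_
    by_cases he1 : e = ℓ₁
    · subst he1; simpa using measurePreserving_mul_right μ g⁻¹
    · by_cases he2 : e = ℓ₂
      · subst he2; simpa [he1] using measurePreserving_mul_right μ g⁻¹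
      · simpa [he1, he2] using MeasurePreserving.id μ
  have hmove : ∀ (s' : Finset (Edge d L)),
      (∀ e : Edge d L, e.1 = y ∨ e.1.shift e.2 = y → e ≠ ℓ₁ → e ≠ ℓ₂ → e ∈ s') →
      ∀ g U, coordAvg μ s' F (T g U) = coordAvg μ s' F U := by
    intro s' hst g U
    rw [hT]
    refine coordAvg_eq_of_gaugeRelated_off s' hF (Pi.mulSingle y g) fun e he => ?_
    by_cases he₂ : e = ℓ₂
    · subst he₂
      rw [update_self, gaugeTransform_mulSingle_apply_of_shift_eq g U h₂' h₂]
    rw [update_of_ne he₂]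
    by_cases he₁ : e = ℓ₁
    · subst he₁
      rw [update_self, gaugeTransform_mulSingle_apply_of_shift_eq g U h₁' h₁]
    rw [update_of_ne he₁]
    have hni : ¬ (e.1 = y ∨ e.1.shift e.2 = y) := fun hi => he (hst e hi he₁ he₂)
    exact (gaugeTransform_mulSingle_apply_of_not_incident y g U (fun h1 => hni (Or.inl h1))
      (fun h2 => hni (Or.inr h2))).symm
  refine integral_abs_sub_avg_le_of_moves s a ℓ₁ hFm hFb hqm hqb T hTmp (hmove s hstar)
    (hmove (insert a s) fun e he h1 h2 => Finset.mem_insert_of_mem (hstar e he h1 h2))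
    (fun g v => v * g⁻¹) (measurable_snd.mul measurable_fst.inv) (fun v => measurePreserving_mul_inv_left v)
    fun g U => ?_
  rw [hT, hq₂]

end Summit.Ventures.LatticeQCDFlow.Theory2.Autoregressive

end
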